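import Summits.Parity.GeneralizedHardyLittlewood.Theses.LiouvilleShiftedTables
import Literature.NumberTheory.LFunctions.SiegelWalfiszLiouville
import Literature.NumberTheory.LFunctions.SiegelWalfiszMoebiusProofs

/-!
# `TypeI2Dilated` (stmt-Parity-14272): the Siegel–Walfisz bracket (negative knowledge, refuter)

Support file for the crux `Summit.Parity.GeneralizedHardyLittlewood.Theses.LiouvilleShiftedTables.TypeI2Dilated`
(X2 of route LiouvilleShiftedTables). Two theorems:

* `not_typeI2DilatedFor_of_logPowerBias` — the crux SHAPE fails for every `f` with a bias
  `≥ η N / q₁` on one residue class of some modulus `q₁ ≤ (log N)^B` for arbitrarily large `N`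
  (Siegel-character signature): any proof of X2 must contain Siegel–Walfisz-strength input.
* `not_logPowerBias_liouville` — `λ` has no such bias: this is Siegel–Walfisz for `λ`, PROVED in
  the tree (`Literature.NumberTheory.LFunctions.SiegelWalfiszMoebius_holds.liouville_progression`).

So the poly-log-conductor content of X2 is settled in tree; the open content is the dilation range
`(log x)^B < q ≤ x^ρ` on `ℓ¹`-average. Extracted from the disprover's work file `Disproof.lean`
(evidence on stmt-Parity-14272).
-/

namespace Summit.Parity.GeneralizedHardyLittlewood.Cruxes.TypeI2Dilated.Negative

open Finset Real
open Summit.Parity.GeneralizedHardyLittlewood.Theses.LiouvilleShiftedTables (TypeI2Dilated)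

/-- The crux shape for a general arithmetic function `f : ℕ → ℝ` in place of `λ`
(verbatim the body of `TypeI2Dilated` with `(ArithmeticFunction.liouville · : ℝ)` replaced by `f`). -/
def TypeI2DilatedFor (f : ℕ → ℝ) : Prop :=
  ∀ c : ℤ, c ≠ 0 → ∃ ρ : ℝ, 0 < ρ ∧ ∀ A : ℝ, 0 < A → ∃ C x₀ : ℝ, ∀ x : ℝ, x₀ ≤ x → ∀ w : ℕ,
    ∀ R S y : ℝ, 1 ≤ R → R ≤ x ^ ρ → 0 ≤ S → S * R ≤ x ^ (1 / 2 + ρ) → 0 ≤ y → y ≤ x →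
      (∑ q ∈ Finset.Icc 1 ⌊x ^ ρ⌋₊, ∑ r ∈ Finset.Icc 1 ⌊R⌋₊, |∑ s ∈ Finset.Icc 1 ⌊S⌋₊,
        ∑ n ∈ (Finset.Icc 1 ⌊y / (s * r)⌋₊).filter (fun n : ℕ => r * s * n ≡ w [MOD q]),
          f (Int.toNat ((r : ℤ) * s * n + c))|) ≤ C * x / Real.log x ^ A

/-- The crux is the `λ`-instance of the generic shape (definitional). -/
theorem typeI2Dilated_iff :
    TypeI2Dilated ↔ TypeI2DilatedFor (fun n => (ArithmeticFunction.liouville n : ℝ)) := Iff.rfl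


/-- Peeling the bottom term and shifting: `∑_{m ≤ N+1, p m} g m = [p 1] g 1 + ∑_{n ≤ N, p(n+1)} g(n+1)`.
[folklore] -/
theorem sum_filter_Icc_succ (g : ℕ → ℝ) (p : ℕ → Prop) [DecidablePred p] (N : ℕ) :
    ∑ m ∈ (Finset.Icc 1 (N + 1)).filter p, g m =
      (if p 1 then g 1 else 0) + ∑ n ∈ (Finset.Icc 1 N).filter (fun n => p (n + 1)), g (n + 1) := by
  rw [Finset.sum_filter, Finset.sum_filter, Finset.Icc_eq_cons_Ioc (by omega : 1 ≤ N + 1),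
    Finset.sum_cons]
  congr 1
  rw [← Finset.Icc_add_one_left_eq_Ioc, ← Finset.map_add_right_Icc, Finset.sum_map]
  rfl


/-- `(log x)^B ≤ K x^s` for `x` large (`s, K > 0`). [folklore] -/
theorem exists_log_rpow_le (B : ℝ) {s K : ℝ} (hs : 0 < s) (hK : 0 < K) :
    ∃ X : ℝ, ∀ x : ℝ, X ≤ x → Real.log x ^ B ≤ K * x ^ s := by
  have h := (isLittleO_log_rpow_rpow_atTop B hs).def hK
  obtain ⟨X, hX⟩ := Filter.eventually_atTop.1 h
  refine ⟨max X 1, fun x hx => ?_⟩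
  have hx1 : 1 ≤ x := (le_max_right _ _).trans hx
  have h1 := hX x ((le_max_left _ _).trans hx)
  rwa [Real.norm_of_nonneg (Real.rpow_nonneg (Real.log_nonneg hx1) _),
    Real.norm_of_nonneg (Real.rpow_nonneg (by linarith) _)] at h1

/-- **Poly-log-conductor bias.** For some `B, η > 0` and arbitrarily large `N` there is a modulus
`q₁ ≤ (log N)^B` and a class `a` with `|∑_{n ≤ N, n ≡ a (q₁)} f(n + 1)| ≥ η N / q₁` — the signature of
an exceptional (Siegel) character `χ (mod q₁)` to which `f` pretends. -/
def LogPowerBias (f : ℕ → ℝ) : Prop :=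
  ∃ B : ℝ, 0 < B ∧ ∃ η : ℝ, 0 < η ∧ ∀ N₀ : ℕ, ∃ N : ℕ, N₀ ≤ N ∧ ∃ q₁ : ℕ, 1 ≤ q₁ ∧
    (q₁ : ℝ) ≤ Real.log N ^ B ∧ ∃ a : ℕ,
      η * N / q₁ ≤ |∑ n ∈ (Finset.Icc 1 N).filter (fun n : ℕ => n ≡ a [MOD q₁]), f (n + 1)|


/-- **Poly-log-conductor bias refutes the crux shape**: take `A = B + 1`; the `(q₁, r = 1)` term is
`≥ η x / q₁ ≥ η x / (log x)^B`, while the right side is `C x / (log x)^{B+1}`. So ANY proof of X2 must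
rule out `λ` pretending to a character of conductor up to every fixed power of `log x` — i.e. it must
contain Siegel–Walfisz-strength (hence Siegel-ineffective) information; nothing weaker than the
`∀ A` log-power currency of the statement can be fed in. -/
theorem not_typeI2DilatedFor_of_logPowerBias {f : ℕ → ℝ} (hf : LogPowerBias f) :
    ¬ TypeI2DilatedFor f := by
  intro hT
  obtain ⟨B, hB, η, hη, hfam⟩ := hf
  obtain ⟨ρ, hρ, hρA⟩ := hT 1 one_ne_zero
  obtain ⟨C, x₀, hx⟩ := hρA (B + 1) (by linarith)
  set C' := max C 0 with hC'def
  have hC'0 : 0 ≤ C' := le_max_right _ _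
  have hCC' : C ≤ C' := le_max_left _ _
  obtain ⟨X₁, hX₁⟩ := exists_log_rpow_le B hρ one_pos
  obtain ⟨N₀, hN₀⟩ := exists_nat_ge (max (max x₀ 3) (max X₁ (Real.exp (C' / η) + 1)))
  obtain ⟨N, hN₀N, q₁, hq₁, hq₁log, a, hbias⟩ := hfam N₀
  have hN : max (max x₀ 3) (max X₁ (Real.exp (C' / η) + 1)) ≤ N :=
    hN₀.trans (by exact_mod_cast hN₀N)
  have hx₀ : x₀ ≤ (N : ℝ) := ((le_max_left _ _).trans (le_max_left _ _)).trans hN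
  have h3N : (3 : ℝ) ≤ N := ((le_max_right _ _).trans (le_max_left _ _)).trans hN
  have hX₁N : X₁ ≤ (N : ℝ) := ((le_max_left _ _).trans (le_max_right _ _)).trans hN
  have heN : Real.exp (C' / η) + 1 ≤ N := ((le_max_right _ _).trans (le_max_right _ _)).trans hN
  have hNpos : (0 : ℝ) < N := by linarith
  have h1N : (1 : ℝ) ≤ N := by linarith
  have hlogpos : 0 < Real.log N := Real.log_pos (by linarith)
  have hq₁' : (0 : ℝ) < q₁ := by exact_mod_cast hq₁
  have key := hx N hx₀ a 1 1 N le_rfl (Real.one_le_rpow h1N hρ.le) zero_le_one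
    (by rw [one_mul]; exact Real.one_le_rpow h1N (by positivity)) (Nat.cast_nonneg N) le_rfl
  simp only [Nat.floor_one, Finset.Icc_self, Finset.sum_singleton, Nat.cast_one, one_mul,
    mul_one, div_one, Nat.floor_natCast] at key
  have htoNat : ∀ n : ℕ, Int.toNat ((n : ℤ) + 1) = n + 1 := fun n => by omega
  simp only [htoNat] at key
  -- `q₁ ≤ (log N)^B ≤ N^ρ`
  have hlogB : Real.log N ^ B ≤ (N : ℝ) ^ ρ := by simpa using hX₁ N hX₁N
  have hmem : q₁ ∈ Finset.Icc 1 ⌊(N : ℝ) ^ ρ⌋₊ :=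
    Finset.mem_Icc.2 ⟨hq₁, Nat.le_floor (hq₁log.trans hlogB)⟩
  have hterm := Finset.single_le_sum (s := Finset.Icc 1 ⌊(N : ℝ) ^ ρ⌋₊)
    (f := fun q => |∑ n ∈ (Finset.Icc 1 N).filter (fun n : ℕ => n ≡ a [MOD q]), f (n + 1)|)
    (fun q _ => abs_nonneg _) hmem
  -- lower bound `η N / (log N)^B ≤ η N / q₁ ≤ term`
  have hlogBpos : 0 < Real.log N ^ B := Real.rpow_pos_of_pos hlogpos B
  have hlow : η * N / Real.log N ^ B ≤ η * N / q₁ :=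
    div_le_div_of_nonneg_left (by positivity) hq₁' hq₁log
  -- upper bound `C N / (log N)^(B+1) < η N / (log N)^B`
  have hsplit : Real.log N ^ (B + 1) = Real.log N ^ B * Real.log N := by
    rw [Real.rpow_add hlogpos, Real.rpow_one]
  have hClog : C' / Real.log N < η := by
    rw [div_lt_iff₀ hlogpos]
    by_cases hC0 : C' = 0
    · rw [hC0]; exact mul_pos hη hlogpos
    · have hC'pos : 0 < C' := lt_of_le_of_ne hC'0 (Ne.symm hC0)
      have h1 : Real.exp (C' / η) < N := by linarith
      have h2 : C' / η < Real.log N := (Real.lt_log_iff_exp_lt hNpos).2 h1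
      rw [div_lt_iff₀ hη] at h2
      linarith
  have hup : C * N / Real.log N ^ (B + 1) < η * N / Real.log N ^ B := by
    rw [hsplit]
    calc C * N / (Real.log N ^ B * Real.log N)
        ≤ C' * N / (Real.log N ^ B * Real.log N) :=
          div_le_div_of_nonneg_right (mul_le_mul_of_nonneg_right hCC' hNpos.le) (by positivity)
      _ = (C' / Real.log N) * (N / Real.log N ^ B) := by
          field_simp
      _ < η * (N / Real.log N ^ B) := mul_lt_mul_of_pos_right hClog (by positivity)
      _ = η * N / Real.log N ^ B := by ring
  linarith [hterm.trans key]

/-- The shift-by-one bookkeeping against Siegel–Walfisz sums: for every `N, q, a`,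
`|∑_{n ≤ N, n ≡ a (q)} λ(n+1)| ≤ |∑_{m ≤ N+1, m ≡ a+1 (q)} λ(m)| + 1`. [folklore] -/
theorem abs_shifted_class_sum_le (N q a : ℕ) :
    |∑ n ∈ (Finset.Icc 1 N).filter (fun n : ℕ => n ≡ a [MOD q]),
        (ArithmeticFunction.liouville (n + 1) : ℝ)| ≤
      |∑ m ∈ (Finset.Icc 1 (N + 1)).filter (fun m : ℕ => (m : ZMod q) = ((a + 1 : ℕ) : ZMod q)),
        (ArithmeticFunction.liouville m : ℝ)| + 1 := by
  have hfilt : (Finset.Icc 1 (N + 1)).filter (fun m : ℕ => (m : ZMod q) = ((a + 1 : ℕ) : ZMod q))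
      = (Finset.Icc 1 (N + 1)).filter (fun m : ℕ => m ≡ a + 1 [MOD q]) :=
    Finset.filter_congr (fun n _ => ZMod.natCast_eq_natCast_iff _ _ _)
  rw [hfilt, sum_filter_Icc_succ]
  have hfilt2 : (Finset.Icc 1 N).filter (fun n : ℕ => n + 1 ≡ a + 1 [MOD q])
      = (Finset.Icc 1 N).filter (fun n : ℕ => n ≡ a [MOD q]) :=
    Finset.filter_congr (fun n _ => ⟨fun h => Nat.ModEq.add_right_cancel' 1 h,
      fun h => Nat.ModEq.add_right 1 h⟩)
  rw [hfilt2]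
  set X := (if 1 ≡ a + 1 [MOD q] then (ArithmeticFunction.liouville 1 : ℝ) else 0) with hXdef
  set Sb := ∑ n ∈ (Finset.Icc 1 N).filter (fun n : ℕ => n ≡ a [MOD q]),
    (ArithmeticFunction.liouville (n + 1) : ℝ) with hSb
  have hX : |X| ≤ 1 := by
    rw [hXdef]; split_ifs
    · rw [ArithmeticFunction.liouville_apply_one]; simp
    · simp
  have h := abs_sub (X + Sb) X
  simp only [add_sub_cancel_left] at h
  linarith

/-- **Exhaustion of the sharper ghost for `λ`: `¬ LogPowerBias λ`** — this IS Siegel–Walfisz for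
`λ` (conductors `q ≤ (log x)^B`, saving `(log x)^{-B-1}`), PROVED in the tree
(`SiegelWalfiszMoebius_holds.liouville_progression`). Together with
`not_typeI2DilatedFor_of_logPowerBias` this brackets the crux exactly: everything a poly-log
conductor can see is settled (in tree!), and the open content is the range
`(log x)^B < q ≤ x^ρ`, reachable only on `ℓ¹`-average (large sieve / dispersion in `q`). -/
theorem not_logPowerBias_liouville :
    ¬ LogPowerBias (fun n => (ArithmeticFunction.liouville n : ℝ)) := by
  rintro ⟨B, hB, η, hη, hfam⟩
  obtain ⟨C, hC⟩ :=
    Literature.NumberTheory.LFunctions.SiegelWalfiszMoebius_holds.liouville_progression hB (B + 1)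
  set C' := max C 0 with hC'def
  have hC'0 : 0 ≤ C' := le_max_right _ _
  have hCC' : C ≤ C' := le_max_left _ _
  -- growth threshold: `(log N)^B ≤ (η/2) N`
  obtain ⟨X₁, hX₁⟩ := exists_log_rpow_le B one_pos (by positivity : 0 < η / 2)
  obtain ⟨N₀, hN₀⟩ := exists_nat_ge (max (max X₁ 3) (Real.exp (8 * C' / η)))
  obtain ⟨N, hN₀N, q₁, hq₁, hq₁log, a, hbias⟩ := hfam N₀
  have hN : max (max X₁ 3) (Real.exp (8 * C' / η)) ≤ N := hN₀.trans (by exact_mod_cast hN₀N)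
  have hX₁N : X₁ ≤ (N : ℝ) := ((le_max_left _ _).trans (le_max_left _ _)).trans hN
  have h3N : (3 : ℝ) ≤ N := ((le_max_right _ _).trans (le_max_left _ _)).trans hN
  have heN : Real.exp (8 * C' / η) ≤ N := (le_max_right _ _).trans hN
  have hNpos : (0 : ℝ) < N := by linarith
  have hlogpos : 0 < Real.log N := Real.log_pos (by linarith)
  have hlogN1 : Real.log N ≤ Real.log ((N : ℝ) + 1) := Real.log_le_log hNpos (by linarith)
  have hlog1pos : 0 < Real.log ((N : ℝ) + 1) := hlogpos.trans_le hlogN1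
  have hq₁' : (0 : ℝ) < q₁ := by exact_mod_cast hq₁
  -- Siegel–Walfisz at height `N + 1`
  have hcond : (q₁ : ℝ) ≤ Real.log ((N : ℝ) + 1) ^ B :=
    hq₁log.trans (Real.rpow_le_rpow hlogpos.le hlogN1 hB.le)
  have hSW := hC ((N : ℝ) + 1) (by linarith) q₁ hq₁ hcond ((a + 1 : ℕ) : ZMod q₁)
  have hfloor : ⌊(N : ℝ) + 1⌋₊ = N + 1 := by exact_mod_cast Nat.floor_natCast (R := ℝ) (N + 1)
  rw [hfloor] at hSW
  have hshift := abs_shifted_class_sum_le N q₁ a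
  -- `(log(N+1))^(B+1) ≥ (log N)^B · log N`
  have hden : Real.log N ^ B * Real.log N ≤ Real.log ((N : ℝ) + 1) ^ (B + 1) := by
    calc Real.log N ^ B * Real.log N = Real.log N ^ (B + 1) := by
          rw [Real.rpow_add hlogpos, Real.rpow_one]
      _ ≤ Real.log ((N : ℝ) + 1) ^ (B + 1) :=
          Real.rpow_le_rpow hlogpos.le hlogN1 (by linarith)
  have hlogBpos : 0 < Real.log N ^ B := Real.rpow_pos_of_pos hlogpos B
  -- (i) the SW term is `< (η/2) N / (log N)^B`
  have hlog8 : 8 * C' / η ≤ Real.log N := by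
    calc 8 * C' / η = Real.log (Real.exp (8 * C' / η)) := (Real.log_exp _).symm
      _ ≤ Real.log N := Real.log_le_log (Real.exp_pos _) heN
  have hi : C * ((N : ℝ) + 1) / Real.log ((N : ℝ) + 1) ^ (B + 1) < η / 2 * N / Real.log N ^ B := by
    have h1 : C * ((N : ℝ) + 1) / Real.log ((N : ℝ) + 1) ^ (B + 1) ≤
        C' * (2 * N) / (Real.log N ^ B * Real.log N) := by
      calc C * ((N : ℝ) + 1) / Real.log ((N : ℝ) + 1) ^ (B + 1)
          ≤ C' * (2 * N) / Real.log ((N : ℝ) + 1) ^ (B + 1) := by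
            refine div_le_div_of_nonneg_right ?_ (by positivity)
            calc C * ((N : ℝ) + 1) ≤ C' * ((N : ℝ) + 1) :=
                  mul_le_mul_of_nonneg_right hCC' (by linarith)
              _ ≤ C' * (2 * N) := mul_le_mul_of_nonneg_left (by linarith) hC'0
        _ ≤ C' * (2 * N) / (Real.log N ^ B * Real.log N) :=
            div_le_div_of_nonneg_left (by positivity) (by positivity) hden
    have h2 : C' * (2 * N) / (Real.log N ^ B * Real.log N) =
        (2 * C' / Real.log N) * (N / Real.log N ^ B) := by
      field_simp
    have h3 : 2 * C' / Real.log N < η / 2 := by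
      rw [div_lt_iff₀ hlogpos]
      have h8 : 8 * C' ≤ η * Real.log N := by
        have h := hlog8; rw [div_le_iff₀ hη] at h; linarith
      nlinarith
    calc C * ((N : ℝ) + 1) / Real.log ((N : ℝ) + 1) ^ (B + 1)
        ≤ (2 * C' / Real.log N) * (N / Real.log N ^ B) := h1.trans (le_of_eq h2)
      _ < η / 2 * (N / Real.log N ^ B) := mul_lt_mul_of_pos_right h3 (by positivity)
      _ = η / 2 * N / Real.log N ^ B := by ring
  -- (ii) `1 ≤ (η/2) N / (log N)^B`
  have hii : (1 : ℝ) ≤ η / 2 * N / Real.log N ^ B := by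
    rw [le_div_iff₀ hlogBpos, one_mul]
    simpa [Real.rpow_one] using hX₁ N hX₁N
  -- (iii) `η N / (log N)^B ≤ η N / q₁ ≤ |bias sum|`
  have hiii : η * N / Real.log N ^ B ≤ η * N / q₁ :=
    div_le_div_of_nonneg_left (by positivity) hq₁' hq₁log
  have : η * N / (q₁ : ℝ) < η * N / Real.log N ^ B := by
    calc η * N / (q₁ : ℝ) ≤ _ := hbias
      _ ≤ _ := hshift
      _ ≤ C * ((N : ℝ) + 1) / Real.log ((N : ℝ) + 1) ^ (B + 1) + 1 := by linarith [hSW]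
      _ < η / 2 * N / Real.log N ^ B + η / 2 * N / Real.log N ^ B := by linarith
      _ = η * N / Real.log N ^ B := by ring
  linarith

end Summit.Parity.GeneralizedHardyLittlewood.Cruxes.TypeI2Dilated.Negative
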